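import Mathlib
import Summits.Ventures.PercRepro2.PMK5Deg2Kernel
import Summits.Ventures.PercRepro2.PMK5Deg2Certs1
import Summits.Ventures.PercRepro2.PMK5Deg2Certs2
import Summits.Ventures.PercRepro2.PMK5Deg2Certs3
import Summits.Ventures.PercRepro2.Deg2Typed

/-!
# THEOREM 27 — THE DEGREE-2 FAMILY: ROW 2′TRI AND (HCOV) ON `K₅ + {a₃x, a₃y}` FOR ALL TEN ATTACHMENT PAIRS
(blind cell PercRepro2, mine-2 g26)

The ten certificates (`cert_ub` and `cert_01` … `cert_24`, one `decide +kernel` each) and the parametrised bridge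
`Deg2Typed.HCov_deg2` give, for every pair `x < y` of vertices of the five-vertex base `K₅(o, a₁, a₂, u, b)` and
the mark `a₃` joined to both: **`typedBases_all`** — row 2′TRI (`CovForm.TypedBases (ends12 x y) 0 1 2 5 4`) — and
**`HCov_deg2_all`** — (HCOV) for every probability vector `p : Fin 12 → R`.  With Theorems 14 / 16 (the pendant
families) this closes (HCOV) in the kernel on every six-vertex graph in which the five marks sit on a five-vertex
base and the sixth vertex `a₃` has degree `≤ 2` into it (missing edges at weight `0`).
-/

namespace Summit.Ventures.PercRepro2

namespace Deg2

/-- **Every pair has its certificate**: `Cert x y` for all `x < y` in `Fin 5`. -/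
theorem cert_all (x y : Fin 5) (hxy : x < y) : Cert x y := by
  fin_cases x <;> fin_cases y
  · exact absurd hxy (by decide)
  · exact cert_01
  · exact cert_02
  · exact cert_03
  · exact cert_04
  · exact absurd hxy (by decide)
  · exact absurd hxy (by decide)
  · exact cert_12
  · exact cert_13
  · exact cert_14
  · exact absurd hxy (by decide)
  · exact absurd hxy (by decide)
  · exact absurd hxy (by decide)
  · exact cert_23
  · exact cert_24
  · exact absurd hxy (by decide)
  · exact absurd hxy (by decide)
  · exact absurd hxy (by decide)
  · exact absurd hxy (by decide)
  · exact cert_ub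
  · exact absurd hxy (by decide)
  · exact absurd hxy (by decide)
  · exact absurd hxy (by decide)
  · exact absurd hxy (by decide)
  · exact absurd hxy (by decide)

section All

variable {R : Type*} [Field R] [LinearOrder R] [IsStrictOrderedRing R]

/-- **THEOREM 27 (typed form): row 2′TRI on every `K₅ + {a₃x, a₃y}`, `x < y`.** -/
theorem typedBases_all (x y : Fin 5) (hxy : x < y) :
    CovForm.TypedBases (R := R) (ends12 x y) 0 1 2 5 4 :=
  typedBases x y (cert_all x y hxy)

/-- **THEOREM 27: (HCOV) on every `K₅ + {a₃x, a₃y}`, `x < y`, for every weight vector.** -/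
theorem HCov_deg2_all (x y : Fin 5) (hxy : x < y) (p : Fin 12 → R) (hp : IsProbVec p) :
    CovForm.HCov p (ends12 x y) 0 1 2 5 4 :=
  HCov_deg2 x y (cert_all x y hxy) p hp

end All

end Deg2

end Summit.Ventures.PercRepro2
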